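import Literature.NumberTheory.EllipticCurves.Disegni2017.CyclotomicLineRankinSelberg
import Literature.NumberTheory.EllipticCurves.PAdicLFunctionInterpolationProofs
import HarnessLib

/-!
# The points of the cyclotomic line: a complex Dirichlet character `θ` and its `ℂ_p`-twin
# `χ_θ = ι⁻¹ ∘ θ⁻¹` along `ι : ℚ̄_p ≅ ℂ` (proofs only)

Topic `Literature/NumberTheory/EllipticCurves`, cluster `Disegni2017` (namespace = path). THEOREMS ONLY
(no definition, no named fact). Companion of `CyclotomicLineRankinSelberg.lean` (Disegni 2017 Thm. A
on the cyclotomic line, typed with COMPLEX characters `θ` mod `p^{m+1}` and the evaluation point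
`cycLinePoint ι θ = ι⁻¹(θ(γ))⁻¹ − 1`). The Mazur–Tate–Teitelbaum interpolation theorems of the tree
(`hasSum_coeff_padicLFunctionBranch_mul_pow_of_isNewformOf`) and the uniqueness principle
(`eq_C_mul_map_mul_map_of_forall_hasSum_of_bounded`) quantify instead over Dirichlet characters with
values in `ℂ_p`. This file is the dictionary between the two (typing sheet
`run/shared/lean/pub/bsd-addord/lit/HFACT-KERNEL-INPUTS.md` §3 (c5): the GEOMETRIC avatar of
`ψ_θ = ofDirichlet θ` is `ι⁻¹ ∘ θ⁻¹`): for `θ : DirichletCharacter ℂ (p^n)` its **`ℂ_p`-twin**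
`(θ⁻¹.ringHomComp ι⁻¹).ringHomComp (ℚ̄_p → ℂ_p)` — written out, no definition is introduced —

* takes the value `ι⁻¹(θ(γ))⁻¹` at the cyclotomic generator, so that its Mazur–Tate–Teitelbaum point
  `χ_θ(γ) − 1` IS `cycLinePoint ι θ` (`twin_apply_cyclotomicGenerator_sub_one`);
* is even iff `θ` is, has the same order, and is primitive iff `θ` is (`twin_even_iff`,
  `orderOf_twin`, `twin_isPrimitive_iff` — post-composition with an injective ring homomorphism
  preserves the kernel of the unit-group homomorphism, hence `FactorsThrough`, hence the conductor);
* and EVERY `ℂ_p`-valued Dirichlet character of finite order is such a twin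
  (`exists_eq_twin_of_isOfFinOrder`): its values are roots of unity of `ℂ_p`, which all come from
  `ℚ̄_p` (`exists_coe_eq_of_pow_eq_one`: `X^k − 1` splits in the algebraically closed `ℚ̄_p` and has
  the same roots in `ℂ_p`), so the character lifts to `ℚ̄_p` (`exists_ringHomComp_eq_of_isOfFinOrder`)
  and is then moved to `ℂ` by `ι`.

References: D. Disegni, Compos. Math. 153 (2017) §1.2 (the spaces `𝒴′ ⊃ 𝒴`, `𝒴_F`; arXiv v3 PDF 6),
Thm. A [Disegni2017]; B. Mazur, J. Tate, J. Teitelbaum, Invent. Math. 84 (1986) §I.13 (characters of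
`Γ` and the points `χ(γ) − 1`) [MazurTateTeitelbaum1986Invent]; M.-L. Hsieh, Doc. Math. 19 (2014)
(the `ι : ℂ ≅ ℂ_p` frame) [Hsieh2014].
-/

noncomputable section

open scoped NumberField
open Polynomial

namespace Literature.NumberTheory.EllipticCurves.Disegni2017

variable {p : ℕ} [Fact p.Prime]

/-! ### Roots of unity of `ℂ_p` come from `ℚ̄_p` -/

/-- **Every root of unity of `ℂ_p` lies in (the image of) `ℚ̄_p`**: if `z^k = 1` in `ℂ_p` with
`k ≠ 0` then `z = ζ₀` for some `ζ₀ ∈ ℚ̄_p` (the monic `X^k − 1` splits over the algebraically closed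
`ℚ̄_p`, and the roots of its image in `ℂ_p[X]` are the images of its roots).
[cite: MazurTateTeitelbaum1986Invent, §I.13 (values of the characters of Γ are p-power roots of unity)] -/
theorem exists_coe_eq_of_pow_eq_one {z : ℂ_[p]} {k : ℕ} (hk : k ≠ 0) (hz : z ^ k = 1) :
    ∃ ζ₀ : PadicAlgCl p, (ζ₀ : ℂ_[p]) = z := by
  classical
  set f : (PadicAlgCl p)[X] := X ^ k - C 1 with hf
  have hf0 : f ≠ 0 := by
    rw [hf]
    exact X_pow_sub_C_ne_zero (Nat.pos_of_ne_zero hk) 1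
  have hsplit : f.Splits := IsAlgClosed.splits f
  have hroots := hsplit.roots_map (algebraMap (PadicAlgCl p) ℂ_[p])
  have hzroot : z ∈ (f.map (algebraMap (PadicAlgCl p) ℂ_[p])).roots := by
    rw [Polynomial.mem_roots (Polynomial.map_ne_zero hf0), Polynomial.IsRoot, hf]
    simp [hz]
  rw [hroots, Multiset.mem_map] at hzroot
  obtain ⟨ζ₀, -, hζ₀⟩ := hzroot
  exact ⟨ζ₀, by rw [PadicComplex.coe_eq]; exact hζ₀⟩

/-- The embedding `ℚ̄_p → ℂ_p` is injective. [cite: MazurTateTeitelbaum1986Invent, §I.13] -/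
theorem coe_padicAlgCl_injective :
    Function.Injective (algebraMap (PadicAlgCl p) ℂ_[p]) :=
  (algebraMap (PadicAlgCl p) ℂ_[p]).injective

/-! ### Lifting a finite-order `ℂ_p`-valued character to `ℚ̄_p` -/

/-- **A `ℂ_p`-valued Dirichlet character of finite order is the image of a `ℚ̄_p`-valued one**:
`χ = χ₀.ringHomComp (ℚ̄_p → ℂ_p)` (each value `χ(a)`, `a` a unit, satisfies `χ(a)^{ord χ} = 1`, so lies
in `ℚ̄_p`; the lifts are unique by injectivity, hence multiplicative).
[cite: MazurTateTeitelbaum1986Invent, §I.13] -/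
theorem exists_ringHomComp_eq_of_isOfFinOrder {n : ℕ} [NeZero n] (χ : DirichletCharacter ℂ_[p] n)
    (hχ : IsOfFinOrder χ) :
    ∃ χ₀ : DirichletCharacter (PadicAlgCl p) n,
      χ₀.ringHomComp (algebraMap (PadicAlgCl p) ℂ_[p]) = χ := by
  classical
  set k := orderOf χ with hk
  have hk0 : k ≠ 0 := (IsOfFinOrder.orderOf_pos hχ).ne'
  -- every unit value is a `k`-th root of unity, hence lifts
  have hval : ∀ a : (ZMod n)ˣ, ∃ ζ₀ : PadicAlgCl p, (ζ₀ : ℂ_[p]) = χ a := by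
    intro a
    refine exists_coe_eq_of_pow_eq_one hk0 ?_
    rw [← MulChar.pow_apply_coe, hk, pow_orderOf_eq_one, MulChar.one_apply_coe]
  choose lift hlift using hval
  have hlift1 : lift 1 = 1 := by
    apply coe_padicAlgCl_injective
    rw [← PadicComplex.coe_eq, hlift 1, Units.val_one, map_one, map_one]
  have hliftmul : ∀ a b : (ZMod n)ˣ, lift (a * b) = lift a * lift b := by
    intro a b
    apply coe_padicAlgCl_injective
    rw [map_mul, ← PadicComplex.coe_eq, ← PadicComplex.coe_eq, ← PadicComplex.coe_eq, hlift, hlift,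
      hlift, Units.val_mul, map_mul]
  have hliftu : ∀ a : (ZMod n)ˣ, IsUnit (lift a) := by
    intro a
    refine isUnit_iff_ne_zero.mpr fun h ↦ ?_
    have h1 := hlift a
    rw [h, PadicComplex.coe_zero] at h1
    have hu : IsUnit (χ (a : ZMod n)) := by
      rw [← MulChar.coe_toUnitHom]; exact Units.isUnit _
    exact hu.ne_zero h1.symm
  -- the unit homomorphism
  let φ : (ZMod n)ˣ →* (PadicAlgCl p)ˣ :=
    { toFun := fun a ↦ (hliftu a).unit
      map_one' := by ext; rw [IsUnit.unit_spec, hlift1, Units.val_one]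
      map_mul' := fun a b ↦ by ext; rw [IsUnit.unit_spec, Units.val_mul, IsUnit.unit_spec,
        IsUnit.unit_spec, hliftmul] }
  refine ⟨MulChar.ofUnitHom φ, ?_⟩
  ext a
  rw [MulChar.ringHomComp_apply, MulChar.ofUnitHom_eq, MulChar.equivToUnitHom_symm_coe,
    ← PadicComplex.coe_eq]
  show ((φ a : PadicAlgCl p) : ℂ_[p]) = χ a
  rw [show ((φ a : (PadicAlgCl p)ˣ) : PadicAlgCl p) = lift a from IsUnit.unit_spec _, hlift]

/-! ### The twin of a complex character -/

section Twin

variable (ι : PadicAlgCl p ≃+* ℂ)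

/-- The embedding after `ι⁻¹` is injective. [cite: MazurTateTeitelbaum1986Invent, §I.13] -/
theorem twinHom_injective :
    Function.Injective ((algebraMap (PadicAlgCl p) ℂ_[p]).comp ι.symm.toRingHom) :=
  coe_padicAlgCl_injective.comp ι.symm.injective

/-- Unfolding: the twin `(θ⁻¹ ∘ ι⁻¹)` pushed to `ℂ_p`, written as ONE `ringHomComp` along the composite
embedding `ℂ →(ι⁻¹) ℚ̄_p → ℂ_p`. [cite: Disegni2017, §1.2 (arXiv v3 PDF 6)] -/
theorem twin_eq_ringHomComp_comp {n : ℕ} (θ : DirichletCharacter ℂ n) :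
    (θ⁻¹.ringHomComp ι.symm.toRingHom).ringHomComp (algebraMap (PadicAlgCl p) ℂ_[p]) =
      θ⁻¹.ringHomComp ((algebraMap (PadicAlgCl p) ℂ_[p]).comp ι.symm.toRingHom) := by
  ext a
  simp only [MulChar.ringHomComp_apply, RingHom.comp_apply]

/-- **The twin's value at a unit**: `χ_θ(a) = ι⁻¹(θ(a))⁻¹` in `ℂ_p`.
[cite: Disegni2017, §1.2 (arXiv v3 PDF 6)] -/
theorem twin_apply_coe {n : ℕ} (θ : DirichletCharacter ℂ n) (a : (ZMod n)ˣ) :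
    ((θ⁻¹.ringHomComp ι.symm.toRingHom).ringHomComp (algebraMap (PadicAlgCl p) ℂ_[p])) a =
      (((ι.symm (θ a) : PadicAlgCl p)) : ℂ_[p])⁻¹ := by
  rw [MulChar.ringHomComp_apply, MulChar.ringHomComp_apply, MulChar.inv_apply_eq_inv',
    RingEquiv.toRingHom_eq_coe, RingHom.coe_coe, map_inv₀, PadicComplex.coe_eq, map_inv₀]

/-- **The twin's Mazur–Tate–Teitelbaum point is the line point**: `χ_θ(γ) − 1 = cycLinePoint ι θ`
(`= ι⁻¹(θ(γ))⁻¹ − 1`) whenever `γ` is a unit modulo `p^{m+1}` (always: `γ = 1 + p^{e₀}`).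
[cite: Disegni2017, Theorem A (arXiv v3 PDF 7); §1.2 (PDF 6)] -/
theorem twin_apply_cyclotomicGenerator_sub_one {m : ℕ} (θ : DirichletCharacter ℂ (p ^ (m + 1))) :
    ((θ⁻¹.ringHomComp ι.symm.toRingHom).ringHomComp (algebraMap (PadicAlgCl p) ℂ_[p]))
        (cyclotomicGenerator p : ZMod (p ^ (m + 1))) - 1 = cycLinePoint ι θ := by
  obtain ⟨u, hu⟩ := isUnit_cyclotomicGenerator_cast p (m + 1)
  rw [cycLinePoint, ← hu, twin_apply_coe]

/-- The twin is even iff `θ` is even. [cite: MazurTateTeitelbaum1986Invent, §I.13] -/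
theorem twin_even_iff {n : ℕ} (θ : DirichletCharacter ℂ n) :
    DirichletCharacter.Even
        ((θ⁻¹.ringHomComp ι.symm.toRingHom).ringHomComp (algebraMap (PadicAlgCl p) ℂ_[p])) ↔
      θ.Even := by
  rw [DirichletCharacter.Even, DirichletCharacter.Even]
  have h1 : ((-1 : ZMod n)) = ((-1 : (ZMod n)ˣ) : ZMod n) := by simp
  rw [h1, twin_apply_coe, inv_eq_one]
  constructor
  · intro h
    have : ι.symm (θ ↑(-1 : (ZMod n)ˣ)) = 1 := by
      apply coe_padicAlgCl_injective
      rw [← PadicComplex.coe_eq, h, map_one]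
    simpa using congr_arg ι this
  · intro h
    rw [h, map_one]
    exact map_one (algebraMap (PadicAlgCl p) ℂ_[p])

/-- The twin has the same order as `θ`. [cite: MazurTateTeitelbaum1986Invent, §I.13] -/
theorem orderOf_twin {n : ℕ} (θ : DirichletCharacter ℂ n) :
    orderOf ((θ⁻¹.ringHomComp ι.symm.toRingHom).ringHomComp (algebraMap (PadicAlgCl p) ℂ_[p])) =
      orderOf θ := by
  rw [twin_eq_ringHomComp_comp]
  have h := orderOf_injective (MulChar.ringHomCompHom
      ((algebraMap (PadicAlgCl p) ℂ_[p]).comp ι.symm.toRingHom))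
    (MulChar.injective_ringHomComp (twinHom_injective ι)) θ⁻¹
  rw [MulChar.ringHomCompHom_apply] at h
  rw [h, orderOf_inv]

/-- Post-composition with an injective ring homomorphism does not change `FactorsThrough`.
[cite: MazurTateTeitelbaum1986Invent, §I.13 (conductors of the characters of Γ)] -/
theorem factorsThrough_ringHomComp_iff {R R' : Type*} [CommRing R] [CommRing R'] {n : ℕ} [NeZero n]
    (χ : DirichletCharacter R n) {f : R →+* R'} (hf : Function.Injective f) {d : ℕ} (hd : d ∣ n) :
    DirichletCharacter.FactorsThrough (χ.ringHomComp f : DirichletCharacter R' n) d ↔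
      χ.FactorsThrough d := by
  rw [DirichletCharacter.factorsThrough_iff_ker_unitsMap hd,
    DirichletCharacter.factorsThrough_iff_ker_unitsMap hd]
  have hker : (MulChar.toUnitHom (χ.ringHomComp f)).ker = (MulChar.toUnitHom χ).ker := by
    ext x
    rw [MonoidHom.mem_ker, MonoidHom.mem_ker, Units.ext_iff, Units.ext_iff,
      MulChar.coe_toUnitHom, MulChar.coe_toUnitHom, MulChar.ringHomComp_apply, Units.val_one,
      Units.val_one]
    constructor
    · intro h; exact hf (by rw [h, map_one])
    · intro h; rw [h, map_one]
  rw [hker]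

/-- Post-composition with an injective ring homomorphism does not change the conductor.
[cite: MazurTateTeitelbaum1986Invent, §I.13] -/
theorem conductor_ringHomComp_eq {R R' : Type*} [CommRing R] [CommRing R'] {n : ℕ} [NeZero n]
    (χ : DirichletCharacter R n) {f : R →+* R'} (hf : Function.Injective f) :
    DirichletCharacter.conductor (χ.ringHomComp f : DirichletCharacter R' n) = χ.conductor := by
  classical
  have hset : DirichletCharacter.conductorSet (χ.ringHomComp f : DirichletCharacter R' n) =
      χ.conductorSet := by
    ext d
    rw [DirichletCharacter.mem_conductorSet_iff, DirichletCharacter.mem_conductorSet_iff]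
    constructor
    · intro h; exact (factorsThrough_ringHomComp_iff χ hf h.dvd).mp h
    · intro h; exact (factorsThrough_ringHomComp_iff χ hf h.dvd).mpr h
  unfold DirichletCharacter.conductor
  rw [hset]

/-- The twin is primitive iff `θ` is. [cite: MazurTateTeitelbaum1986Invent, §I.13] -/
theorem twin_isPrimitive_iff {n : ℕ} [NeZero n] (θ : DirichletCharacter ℂ n) :
    DirichletCharacter.IsPrimitive
        ((θ⁻¹.ringHomComp ι.symm.toRingHom).ringHomComp (algebraMap (PadicAlgCl p) ℂ_[p]) :
          DirichletCharacter ℂ_[p] n) ↔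
      θ.IsPrimitive := by
  rw [twin_eq_ringHomComp_comp, DirichletCharacter.isPrimitive_def,
    conductor_ringHomComp_eq _ (twinHom_injective ι), DirichletCharacter.conductor_inv,
    ← DirichletCharacter.isPrimitive_def]

/-- **Every finite-order `ℂ_p`-valued Dirichlet character is the twin of a complex one** (lift to
`ℚ̄_p`, move to `ℂ` by `ι`, invert): `χ = χ_θ` with `θ := (χ₀.ringHomComp ι)⁻¹`.
[cite: MazurTateTeitelbaum1986Invent, §I.13] [cite: Disegni2017, §1.2 (arXiv v3 PDF 6)] -/
theorem exists_eq_twin_of_isOfFinOrder {n : ℕ} [NeZero n] (χ : DirichletCharacter ℂ_[p] n)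
    (hχ : IsOfFinOrder χ) :
    ∃ θ : DirichletCharacter ℂ n,
      (θ⁻¹.ringHomComp ι.symm.toRingHom).ringHomComp (algebraMap (PadicAlgCl p) ℂ_[p]) = χ := by
  obtain ⟨χ₀, hχ₀⟩ := exists_ringHomComp_eq_of_isOfFinOrder χ hχ
  refine ⟨(χ₀.ringHomComp ι.toRingHom)⁻¹, ?_⟩
  rw [inv_inv, ← hχ₀]
  ext a
  simp only [MulChar.ringHomComp_apply, RingEquiv.toRingHom_eq_coe, RingHom.coe_coe,
    RingEquiv.symm_apply_apply]

end Twin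

end Literature.NumberTheory.EllipticCurves.Disegni2017

end
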